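import Summits.QuantumFields.YangMills.Theorems.UnitScaleTiltProp7SectET3CurvedPropagatorsT3
import Summits.QuantumFields.YangMills.Theorems.UnitScaleTiltProp7QTwSRealityOfRegPr
import Mathlib.Analysis.InnerProductSpace.Projection.Submodule
import HarnessLib

/-!
# Route `UnitScaleTilt`, crux «MinimiserStabilityRegPr» (stmt-QuantumFields-19200, stub EX `stub_existenceMinimalOrbit`, route (α)) — «HERM-DENSITY»: **FROM CRITICALITY ON THE HERMITIAN PART OF
# `ker Q` TO `range Q*`** — the linear-algebra step between print's (127) («⟨δA′, …⟩ = 0 for all (real) δA′ with QδA′ = 0») and (128) («`J + Δ_aA′ + … ∈ range Q*`», i.e. `= Q*μ`) on the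
# complexified weighted `L²` space of brick L0a∕L0d: `(∀ Hermitian a with Q a = 0, ⟪toL2 a, X⟫ = 0) ⇒ ∃ μ, X = Q_k† μ`

Cell `ym3-torus` (HUMAN RULING D-0037, YM ladder rung R3 — YM₃ on T³, NOT d = 4, NOT Clay; YM gap NOT proved), width seat `ym3-torus-px21` gen 2 (explicit-unit helper; S11 reshape at the slot
`Δ^η`, ★★OWNER RULING g28-№9; LOCATE «HMULT-127» §3–§4; my 22:45Z list item (iii)).  THEOREMS ONLY (0 `def`, 0 `sorry`); `--supports stmt-QuantumFields-19200 --as helper`, count-neutral.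

THE PRINT.  [Balaban1985Variational] p. 297: «(127) for all δA′ satisfying QδA′ = 0 … the above equation can be written as ⟨δA′, J⟩ + ⟨δA′, Δ_aA₁′⟩ − … = 0 (128)», then solved with `G = Δ_a⁻¹`
and `H₀ = GQ*(QGQ*)⁻¹` ((129)–(130)) — i.e. the residual is `Q*μ`.  Print's fields are REAL (`𝔤`-valued); the tree's `L²` letters are complex, the real structure being `a ↦ aᴴ` on the exponent
fields (`toL2`) with `Q(aᴴ) = (Qa)ᴴ` at `U₀ ∈ 𝔘_k(ε₀)` (✓`QTwS_star_comm_of_regPr`).  So «for all real δA′ ∈ ker Q» becomes «for all Hermitian `a` with `QTwS a = 0`», and the passage to ALL of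
`ker Q_k` is `a = ½(a + aᴴ) + i·(−i∕2)(a − aᴴ)` + sesquilinearity; `(ker Q_k)ᗮ = range Q_k†` is finite-dimensional linear algebra.

WHAT IS PROVED (member `F`, `K n`, `h : n ≤ K`, weights `c₀ cB`; ns `…Theorems.Prop7HermDensity`):
* §1 `Qk_toL2_eq_zero_iff` (`Q_k(toL2 a) = 0 ↔ QTwS U₀ a = 0`), `ker_Qk_eq_orthogonal_range_adjoint` (`ker Q_k = (range Q_k†)ᗮ`), ★`exists_eq_adjoint_Qk_of_orthogonal_ker`
  (`(∀ w, Q_k w = 0 → ⟪w, X⟫ = 0) → ∃ μ, X = Q_k† μ`).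
* §2 ★★★**`exists_eq_adjoint_Qk_of_hermitian (hQ : ∀ A, QTwS U₀ Aᴴ = (QTwS U₀ A)ᴴ) (h : ∀ a, aᴴ = a → QTwS U₀ a = 0 → ⟪toL2 a, X⟫ = 0) : ∃ μ, X = Q_k† μ`** and its unconditional form
  ★★`exists_eq_adjoint_Qk_of_hermitian_regPr` at `U₀ ∈ 𝔘_k(ε₀)` in the windows `10⁹L²e ≤ 1`, `10¹²L³ε₀ ≤ 1`.
HONEST SCOPE.  Linear algebra; no estimate; not a proof of any stub; nothing continuum ∕ OS ∕ mass-gap ∕ Clay.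

References: T. Bałaban, CMP **102** (1985) 277–309 [Balaban1985Variational] ((127)–(130) p.297, (51) p.286); CMP **99** (1985) 389–434 [Balaban1985BackgroundPropagators] ((3.13)–(3.15) p.393).
-/

set_option autoImplicit false

noncomputable section

open scoped InnerProductSpace ComplexConjugate Matrix.Norms.L2Operator BigOperators

namespace Summit.QuantumFields.YangMills.Theorems.Prop7HermDensity

open Literature.MathematicalPhysics.QuantumFieldTheory.Balaban1983to89
open Literature.MathematicalPhysics.QuantumFieldTheory.Balaban1983to89.T3ContinuumYM3Torus
open T3SectALandauChart (eta eta_pos)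
open T3PrintedRegularMinimiser (RegPr)
open B9SectCLatticeCarrier (Bond)
open B9Eq311L2Pairing (WL2)
open B11Eq103H1Complex (SiteL2K BondL2K)
open Summit.QuantumFields.YangMills.Theorems.Prop7SectET3Transport (periodsT3)
open Summit.QuantumFields.YangMills.Theorems.Prop7SectET3HilbertLetters (W₂ toL2 toL2B QL2 QL2_toL2)
open Summit.QuantumFields.YangMills.Theorems.Prop7SectET3CurvedPropagators (Qk)
open Summit.QuantumFields.YangMills.Theorems.Prop7SymAvgTwSym (QTwS QTwS_star_comm_of_regPr)

variable {F : T3Family} {n K : ℕ} {h : n ≤ K} {c₀ cB : ℝ} [Fact (0 < c₀)] [Fact (0 < cB)]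

/-! ## §1 `ker Q_k` on the exponent fields; `(ker Q_k)ᗮ = range Q_k†` -/

omit [Fact (0 < c₀)] [Fact (0 < cB)] in
/-- **`Q_k(toL2 a) = 0 ↔ QTwS U₀ a = 0`** (`Q_k = η • QL2`, `QL2 ∘ toL2 = toL2B ∘ QTwS`, `η ≠ 0`, `toL2B` injective). [cite: Balaban1985Variational, (44)–(45) p.285] -/
theorem Qk_toL2_eq_zero_iff (U₀ : GaugeField (F.P K) 0 (Matrix.specialUnitaryGroup (Fin 2) ℂ)) (a : PBond (F.P K) 0 → Matrix (Fin 2) (Fin 2) ℂ) :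
    Qk F n K h c₀ cB U₀ (toL2 F K c₀ a) = 0 ↔ QTwS F n K h U₀ a = 0 := by
  have hη : (((eta F n K : ℝ) : ℂ)) ≠ 0 := Complex.ofReal_ne_zero.2 (eta_pos F n K).ne'
  rw [Qk, LinearMap.smul_apply, QL2_toL2, smul_eq_zero, LinearEquiv.map_eq_zero_iff]
  exact ⟨fun hq => hq.resolve_left hη, fun hq => Or.inr hq⟩

/-- **`ker Q_k = (range Q_k†)ᗮ`** (`⟪Q_k†μ, w⟫ = ⟪μ, Q_k w⟫`). [cite: Balaban1985Variational, (128)–(129) p.297] -/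
theorem ker_Qk_eq_orthogonal_range_adjoint (U₀ : GaugeField (F.P K) 0 (Matrix.specialUnitaryGroup (Fin 2) ℂ)) :
    LinearMap.ker (Qk F n K h c₀ cB U₀) = (LinearMap.range (LinearMap.adjoint (Qk F n K h c₀ cB U₀)))ᗮ := by
  ext w
  rw [LinearMap.mem_ker, Submodule.mem_orthogonal]
  constructor
  · rintro hw _ ⟨μ, rfl⟩
    rw [LinearMap.adjoint_inner_left, hw, inner_zero_right]
  · intro hw
    refine ext_inner_left ℂ fun μ => ?_
    rw [inner_zero_right, ← LinearMap.adjoint_inner_left]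
    exact hw _ ⟨μ, rfl⟩

/-- ★ **`(∀ w ∈ ker Q_k, ⟪w, X⟫ = 0) ⇒ X = Q_k†μ`** (`(ker Q_k)ᗮ = (range Q_k†)ᗮᗮ = range Q_k†`, finite dimension). [cite: Balaban1985Variational, (128)–(129) p.297] -/
theorem exists_eq_adjoint_Qk_of_orthogonal_ker (U₀ : GaugeField (F.P K) 0 (Matrix.specialUnitaryGroup (Fin 2) ℂ)) {X : BondL2K ℂ 3 (periodsT3 F K) c₀ W₂}
    (hX : ∀ w : BondL2K ℂ 3 (periodsT3 F K) c₀ W₂, Qk F n K h c₀ cB U₀ w = 0 → ⟪w, X⟫_ℂ = 0) :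
    ∃ μ : WL2 ℂ (fun _ : PBond (F.P n) 0 => cB) W₂, X = LinearMap.adjoint (Qk F n K h c₀ cB U₀) μ := by
  have hmem : X ∈ (LinearMap.ker (Qk F n K h c₀ cB U₀))ᗮ := by
    rw [Submodule.mem_orthogonal]
    intro w hw
    exact hX w (LinearMap.mem_ker.1 hw)
  rw [ker_Qk_eq_orthogonal_range_adjoint, Submodule.orthogonal_orthogonal] at hmem
  obtain ⟨μ, hμ⟩ := hmem
  exact ⟨μ, hμ.symm⟩

/-! ## §2 ★★★ From the Hermitian part of `ker Q` to `range Q_k†` -/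

/-- ★★★ **HERMITIAN DENSITY**: if `QTwS U₀` commutes with `a ↦ aᴴ` and `⟪toL2 a, X⟫ = 0` for every HERMITIAN `a` with `QTwS U₀ a = 0`, then `X = Q_k†μ` for some `μ` — every `w ∈ ker Q_k` is
`toL2 (a₁ + i·a₂)` with `a₁ = ½(a + aᴴ)`, `a₂ = (−i∕2)(a − aᴴ)` Hermitian and in `ker QTwS`. [cite: Balaban1985Variational, (127)–(128) p.297, (51) p.286] -/
theorem exists_eq_adjoint_Qk_of_hermitian (U₀ : GaugeField (F.P K) 0 (Matrix.specialUnitaryGroup (Fin 2) ℂ))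
    (hQ : ∀ A : PBond (F.P K) 0 → Matrix (Fin 2) (Fin 2) ℂ, QTwS F n K h U₀ (star A) = star (QTwS F n K h U₀ A)) {X : BondL2K ℂ 3 (periodsT3 F K) c₀ W₂}
    (hX : ∀ a : PBond (F.P K) 0 → Matrix (Fin 2) (Fin 2) ℂ, star a = a → QTwS F n K h U₀ a = 0 → ⟪toL2 F K c₀ a, X⟫_ℂ = 0) :
    ∃ μ : WL2 ℂ (fun _ : PBond (F.P n) 0 => cB) W₂, X = LinearMap.adjoint (Qk F n K h c₀ cB U₀) μ := by
  refine exists_eq_adjoint_Qk_of_orthogonal_ker U₀ fun w hw => ?_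
  -- read `w = toL2 a`, `QTwS a = 0`
  obtain ⟨a, rfl⟩ : ∃ a, toL2 F K c₀ a = w := ⟨(toL2 F K c₀).symm w, (toL2 F K c₀).apply_symm_apply w⟩
  rw [Qk_toL2_eq_zero_iff] at hw
  -- the Hermitian parts
  set a₁ : PBond (F.P K) 0 → Matrix (Fin 2) (Fin 2) ℂ := (2 : ℂ)⁻¹ • (a + star a) with ha₁_def
  set a₂ : PBond (F.P K) 0 → Matrix (Fin 2) (Fin 2) ℂ := (-(Complex.I / 2)) • (a - star a) with ha₂_def
  have hstar₁ : star a₁ = a₁ := by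
    rw [ha₁_def, star_smul, star_add, star_star, add_comm (star a) a]
    norm_num
  have hstar₂ : star a₂ = a₂ := by
    rw [ha₂_def, star_smul, star_sub, star_star, star_neg, star_div₀, Complex.star_def, Complex.conj_I, map_ofNat, ← neg_sub (a) (star a), smul_neg, ← neg_smul]
    congr 1
    ring
  have hQ₁ : QTwS F n K h U₀ a₁ = 0 := by rw [ha₁_def, map_smul, map_add, hQ, hw, star_zero, add_zero, smul_zero]
  have hQ₂ : QTwS F n K h U₀ a₂ = 0 := by rw [ha₂_def, map_smul, map_sub, hQ, hw, star_zero, sub_zero, smul_zero]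
  have hdec : a = a₁ + Complex.I • a₂ := by
    rw [ha₁_def, ha₂_def, smul_smul, show Complex.I * -(Complex.I / 2) = (2 : ℂ)⁻¹ by rw [mul_neg, mul_div_assoc', Complex.I_mul_I]; norm_num, ← smul_add]
    rw [show a + star a + (a - star a) = (2 : ℂ) • a by rw [two_smul]; abel, smul_smul, inv_mul_cancel₀ two_ne_zero, one_smul]
  rw [hdec, map_add, inner_add_left, hX a₁ hstar₁ hQ₁, map_smul, inner_smul_left, hX a₂ hstar₂ hQ₂, mul_zero, add_zero]

/-- ★★ **HERMITIAN DENSITY AT `U₀ ∈ 𝔘_k(ε₀)`** in the windows `10⁹L²e ≤ 1`, `10¹²L³ε₀ ≤ 1` (`QTwS`'s ᴴ-row ✓`QTwS_star_comm_of_regPr`). [cite: Balaban1985Variational, (127)–(128) p.297, (51) p.286] -/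
theorem exists_eq_adjoint_Qk_of_hermitian_regPr [Fact (0 < (F.L : ℝ))] [Fact (0 < ((F.L : ℝ)⁻¹) ^ (K - n))]
    {ε₀ e : ℝ} (hε₀ : 0 < ε₀) (he : 0 < e) (hWe : 10 ^ 9 * (F.L : ℝ) ^ 2 * e ≤ 1) (hWε : 10 ^ 12 * (F.L : ℝ) ^ 3 * ε₀ ≤ 1)
    (U₀ : GaugeField (F.P K) 0 (Matrix.specialUnitaryGroup (Fin 2) ℂ)) (hreg : RegPr F n K ε₀ U₀) {X : BondL2K ℂ 3 (periodsT3 F K) c₀ W₂}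
    (hX : ∀ a : PBond (F.P K) 0 → Matrix (Fin 2) (Fin 2) ℂ, star a = a → QTwS F n K h U₀ a = 0 → ⟪toL2 F K c₀ a, X⟫_ℂ = 0) :
    ∃ μ : WL2 ℂ (fun _ : PBond (F.P n) 0 => cB) W₂, X = LinearMap.adjoint (Qk F n K h c₀ cB U₀) μ :=
  exists_eq_adjoint_Qk_of_hermitian U₀ (QTwS_star_comm_of_regPr F h hε₀ he hWe hWε U₀ hreg) hX

/-! ## §3 The same from the TRACELESS Hermitian part of `ker Q` (the `𝔰𝔲(2)` directions of `hCrit127`), for a traceless residual -/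

/-- ★★★ **HERMITIAN–TRACELESS DENSITY**: if `QTwS U₀` commutes with `ᴴ`, preserves the traceless sector (`hQtr`) and the scalar sector (`hQsc`), the residual `X` is traceless (`hXtr`), and
`⟪toL2 a, X⟫ = 0` for every Hermitian TRACELESS `a` with `QTwS U₀ a = 0` (the directions of `hCrit127`), then `X = Q_k†μ` — a Hermitian `a ∈ ker Q` splits as `a⁰ + c•1` with `a⁰` Hermitian
traceless and `c` its half-trace; `Q a⁰` is traceless and `Q(c•1)` scalar, so `Q a = 0` forces both to vanish; the scalar part pairs to `0` with a traceless `X`.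
[cite: Balaban1985Variational, (127)–(128) p.297, (51) p.286; Balaban1985BackgroundPropagators, (3.14)–(3.15) p.393] -/
theorem exists_eq_adjoint_Qk_of_hermitian_traceless (U₀ : GaugeField (F.P K) 0 (Matrix.specialUnitaryGroup (Fin 2) ℂ))
    (hQ : ∀ A : PBond (F.P K) 0 → Matrix (Fin 2) (Fin 2) ℂ, QTwS F n K h U₀ (star A) = star (QTwS F n K h U₀ A))
    (hQtr : ∀ A : PBond (F.P K) 0 → Matrix (Fin 2) (Fin 2) ℂ, (∀ b, (A b).trace = 0) → ∀ c, (QTwS F n K h U₀ A c).trace = 0)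
    (hQsc : ∀ c : PBond (F.P K) 0 → ℂ, ∃ d : PBond (F.P n) 0 → ℂ, QTwS F n K h U₀ (fun b => c b • (1 : Matrix (Fin 2) (Fin 2) ℂ)) = fun c' => d c' • 1)
    {X : BondL2K ℂ 3 (periodsT3 F K) c₀ W₂} (hXtr : ∀ b, ((toL2 F K c₀).symm X b).trace = 0)
    (hX : ∀ a : PBond (F.P K) 0 → Matrix (Fin 2) (Fin 2) ℂ, star a = a → (∀ b, (a b).trace = 0) → QTwS F n K h U₀ a = 0 → ⟪toL2 F K c₀ a, X⟫_ℂ = 0) :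
    ∃ μ : WL2 ℂ (fun _ : PBond (F.P n) 0 => cB) W₂, X = LinearMap.adjoint (Qk F n K h c₀ cB U₀) μ := by
  refine exists_eq_adjoint_Qk_of_hermitian U₀ hQ fun a ha hQa => ?_
  -- split `a = a⁰ + c•1`, `c = tr(a)/2`
  set c : PBond (F.P K) 0 → ℂ := fun b => (2 : ℂ)⁻¹ * (a b).trace with hc_def
  set a₀ : PBond (F.P K) 0 → Matrix (Fin 2) (Fin 2) ℂ := a - fun b => c b • (1 : Matrix (Fin 2) (Fin 2) ℂ) with ha₀_def
  have htr1 : Matrix.trace (1 : Matrix (Fin 2) (Fin 2) ℂ) = 2 := by rw [Matrix.trace_one, Fintype.card_fin]; norm_num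
  have ha₀tr : ∀ b, (a₀ b).trace = 0 := fun b => by
    rw [ha₀_def, Pi.sub_apply, Matrix.trace_sub, Matrix.trace_smul, htr1, smul_eq_mul, hc_def]; ring
  have hcreal : ∀ b, star (c b) = c b := fun b => by
    have h1 : star ((a b).trace) = (a b).trace := by
      rw [← Matrix.trace_conjTranspose, ← Matrix.star_eq_conjTranspose, ← Pi.star_apply, ha]
    rw [hc_def]
    simp only [star_mul, star_inv₀, star_ofNat, h1, mul_comm]
  have ha₀star : star a₀ = a₀ := by
    funext b
    have hab : star (a b) = a b := by
      have h1 := congrFun ha b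
      rwa [Pi.star_apply] at h1
    rw [ha₀_def, Pi.star_apply, Pi.sub_apply, star_sub, star_smul, hcreal, star_one, hab]
  -- `Q a⁰` traceless, `Q(c•1)` scalar, sum zero ⇒ both zero
  obtain ⟨d, hd⟩ := hQsc c
  have hsum : QTwS F n K h U₀ a₀ + (fun c' => d c' • (1 : Matrix (Fin 2) (Fin 2) ℂ)) = 0 := by
    rw [← hd, ← map_add, ha₀_def, sub_add_cancel, hQa]
  have hd0 : ∀ c', d c' = 0 := fun c' => by
    have h1 := congrArg (fun f => Matrix.trace (f c')) hsum
    simp only [Pi.add_apply, Pi.zero_apply, Matrix.trace_add, Matrix.trace_zero, Matrix.trace_smul, htr1, smul_eq_mul, hQtr a₀ ha₀tr c', zero_add] at h1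
    simpa using h1
  have hQa₀ : QTwS F n K h U₀ a₀ = 0 := by
    have : (fun c' => d c' • (1 : Matrix (Fin 2) (Fin 2) ℂ)) = 0 := funext fun c' => by rw [hd0, zero_smul]; rfl
    rwa [this, add_zero] at hsum
  -- the scalar part pairs to zero with a traceless `X`
  have hX' : X = toL2 F K c₀ ((toL2 F K c₀).symm X) := ((toL2 F K c₀).apply_symm_apply X).symm
  have hsc : ⟪toL2 F K c₀ (fun b => c b • (1 : Matrix (Fin 2) (Fin 2) ℂ)), X⟫_ℂ = 0 := by
    rw [hX', Prop7SectET3HilbertLetters.inner_toL2]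
    simp only [Matrix.conjTranspose_smul, Matrix.conjTranspose_one, Matrix.smul_mul, Matrix.one_mul, Matrix.trace_smul, hXtr, smul_zero, Finset.sum_const_zero, mul_zero]
  have hdec : a = a₀ + fun b => c b • (1 : Matrix (Fin 2) (Fin 2) ℂ) := by rw [ha₀_def, sub_add_cancel]
  rw [hdec, map_add, inner_add_left, hX a₀ ha₀star ha₀tr hQa₀, hsc, add_zero]

end Summit.QuantumFields.YangMills.Theorems.Prop7HermDensity

end
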